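import Summits.QuantumFields.YangMills.Theorems.BalabanLadderNTReferenceTorusTwoPoint
import Summits.QuantumFields.YangMills.Theorems.BalabanLadderNTReferenceTorusThreePoint
import HarnessLib

/-!
# Leaf `InfiniteVolumeContinuum.HypercubicOSDataFromInfiniteVolume` (stmt-QuantumFields-19868), registered stub
# N `stub_onsetFloorsK : OnsetFloorsK` — part 1/2: the periodic-reference torus transfer WITH EXPLICIT WITNESSES

Helper file (`--supports stmt-QuantumFields-19868`) of prover seat `ymfull-r2a-prover-1` (R590-ym item 13) on the
skeleton of record `Cruxes/HypercubicOSDataFromInfiniteVolume/Lines/octave_doubling.lean` (REV 2.1), stub N.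

WHY.  `OnsetFloorsK` is the onset-floor residual in the COMPACT-WITNESS currency.  The registered engine stub of the
spine's crux `NT` (stmt-QuantumFields-19353, skeleton v4T «periodic-reference», `stub_refpkgT : RefPkgT`) asks for floor
witnesses supported in `closedBall 0 σ`; the landed transfer `Reference.lowerBounds_fst/snd_of_torusReference`
(reference-state series VII/VIII) moves the floors from ONE torus per coupling to EVERY torus with THE SAME witnesses,
but its `∃`-conclusion forgets them.  This file re-runs that last step keeping the witnesses in the statement:

* `floor_fst_of_torusReference` — (E1/E2-osc) + a two-point floor with transfer margin on one torus per coupling for a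
  GIVEN `v ⊆ closedBall 0 σ` ⇒ the floor `ε ≤ Q2_{β,L,aβ}(θv, v)` on every torus `a β · L ≥ σ + κ + 1`, `β` large;
* `floor_snd_of_torusReference` — (E1/E2/E3-osc) + the three-point floor with margin for GIVEN `f, g, h` ⇒
  `ε ≤ |Q3_{β,L,aβ}(f, g, h)|` likewise.

Part 2 (`…OnsetFloorsKOfReference.lean`) packages them as `LowerBoundsK` and `OnsetFloorsK`.
Proofs adapted from the landed `…BalabanLadderNTReferenceTorusTwoPoint/ThreePoint.lean` (same lemmas by name).

HONEST LABEL: CONDITIONAL bookkeeping on the NT engine hypotheses (open, XL, unprinted); nothing here proves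
non-triviality, a β-uniform bound, the leaf, any crux, rung or summit; finite-volume / conditional content only; the
Yang–Mills mass gap is NOT proved.
-/

set_option autoImplicit false

noncomputable section

open scoped SchwartzMap
open MeasureTheory Filter Topology
open Literature.MathematicalPhysics.QuantumFieldTheory Literature.MathematicalPhysics.QuantumLattice
open Literature.Probability.LatticeModels
open Summit.QuantumFields.YangMills.Cruxes.OSLegsFromFemtoAndGap.DlrCollarTransfer
open Summit.QuantumFields.YangMills.Cruxes.NT.Reference

namespace Summit.QuantumFields.YangMills.Cruxes.HypercubicOSDataFromInfiniteVolume.OnsetFloorsN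

section Torus

variable (G : Type) [Group G] [TopologicalSpace G] [IsTopologicalGroup G] [CompactSpace G]
  [MeasurableSpace G] [BorelSpace G] (r : LatticeRep G)

/-- **Two-point floor on every torus, explicit witness.**  Unit map `a` (`0 < a`, `a → 0`), constants `C₁, C₂ ≥ 0`,
femto scale `ℓ`, support radius `σ > 0`, collar `κ > 0`, `2(σ+κ) < ℓ`; (E1-osc), (E2-osc); a test function `v`
supported in `closedBall 0 σ` and, for `β ≥ β₅`, ONE torus `2L₀(β)+1` with `a β · L₀(β) ≥ σ + κ + 1` on which
`Q2_{β,L₀(β),aβ}(θv, v) ≥ ε +` the two-point transfer margin.  Then THIS `v` carries `ε ≤ Q2_{β,L,aβ}(θv, v)` on every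
torus `2L+1` with `a β · L ≥ σ + κ + 1`, for all large `β` (the landed `lowerBounds_fst_of_torusReference` with the
witness kept in the statement). [folklore] -/
theorem floor_fst_of_torusReference (a : ℝ → ℝ) (ha₀ : ∀ β, 0 < a β) (ha : Tendsto a atTop (𝓝 0))
    {C₁ C₂ ℓ σ κ : ℝ} (hC₁ : 0 ≤ C₁) (hC₂ : 0 ≤ C₂) (hσ : 0 < σ) (hκ : 0 < κ) (hℓ : 2 * (σ + κ) < ℓ)
    (hE1 : ∃ β₁ : ℝ, ∀ β : ℝ, β₁ ≤ β → ∀ (c : Fin 4 → ℤ) (b : ℕ), (b : ℝ) * a β ≤ ℓ →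
      ∀ (η η' : LGConfig 4 G) (x : Fin 4 → ℤ), 1 ≤ depth c b x →
        |kerE G r β c b η (dens G r x) - kerE G r β c b η' (dens G r x)| ≤ C₁ / (depth c b x : ℝ) ^ 4)
    (hE2 : ∃ β₂ : ℝ, ∀ β : ℝ, β₂ ≤ β → ∀ (c : Fin 4 → ℤ) (b : ℕ), (b : ℝ) * a β ≤ ℓ →
      ∀ (η η' : LGConfig 4 G) (x y : Fin 4 → ℤ), 1 ≤ depth c b x → 1 ≤ depth c b y →
        |kerCov G r β c b η (dens G r x) (dens G r y) - kerCov G r β c b η' (dens G r x) (dens G r y)| ≤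
          C₂ / ((min (depth c b x) (depth c b y) : ℕ) : ℝ) ^ 4 / (1 + ‖siteToE (y - x)‖) ^ 4)
    {v : 𝓢(EuclideanSpace ℝ (Fin 4), ℝ)} {ε β₅ : ℝ} {L₀ : ℝ → ℕ}
    (hvσ : tsupport (v : EuclideanSpace ℝ (Fin 4) → ℝ) ⊆ Metric.closedBall 0 σ)
    (HR : ∀ β : ℝ, β₅ ≤ β → σ + κ + 1 ≤ a β * L₀ β ∧
        ε + 2 * (C₁ * (a β / κ) ^ 4 * ∑ x ∈ box 4 (L₀ β), |thetaTest 4 v (a β • siteToE x)|) *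
              (C₁ * (a β / κ) ^ 4 * ∑ y ∈ box 4 (L₀ β), |v (a β • siteToE y)|) +
            C₂ * (a β / κ) ^ 4 * ∑ x ∈ box 4 (L₀ β), ∑ y ∈ box 4 (L₀ β),
              |thetaTest 4 v (a β • siteToE x)| * |v (a β • siteToE y)| / (1 + ‖siteToE (y - x)‖) ^ 4 ≤
          Q2 G r β (L₀ β) (a β) (thetaTest 4 v) v) :
    ∃ β₅' : ℝ, ∀ β : ℝ, β₅' ≤ β → ∀ L : ℕ, σ + κ + 1 ≤ a β * L → ε ≤ Q2 G r β L (a β) (thetaTest 4 v) v := by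
  -- adapted from the landed `Reference.lowerBounds_fst_of_torusReference` (same proof, witness explicit)
  obtain ⟨β₁, H1⟩ := hE1
  obtain ⟨β₂, H2⟩ := hE2
  have hδ : 0 < min (1 / 4 : ℝ) ((ℓ - 2 * (σ + κ)) / 5) := lt_min (by norm_num) (by linarith)
  obtain ⟨βa, Ha⟩ := eventually_le_of_tendsto ha hδ
  refine ⟨max (max β₅ βa) (max β₁ β₂), fun β hβ L hL => ?_⟩
  have hβ₅ : β₅ ≤ β := le_trans (le_max_left _ _) (le_trans (le_max_left _ _) hβ)
  have hβa : βa ≤ β := le_trans (le_max_right _ _) (le_trans (le_max_left _ _) hβ)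
  have hβ₁ : β₁ ≤ β := le_trans (le_max_left _ _) (le_trans (le_max_right _ _) hβ)
  have hβ₂ : β₂ ≤ β := le_trans (le_max_right _ _) (le_trans (le_max_right _ _) hβ)
  have hα : 0 < a β := ha₀ β
  have hsmall := Ha β hβa
  have h4 : a β ≤ 1 / 4 := hsmall.trans (min_le_left _ _)
  have hℓ' : a β ≤ (ℓ - 2 * (σ + κ)) / 5 := hsmall.trans (min_le_right _ _)
  have hρ' : a β ≤ ((σ + κ + 2 * a β) - σ - κ) / 2 := by linarith
  obtain ⟨hL₀, HRβ⟩ := HR β hβ₅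
  obtain ⟨-, hfem, hLL, hNL, -, hdep⟩ := scales hα hσ hκ h4 hρ' hℓ' hL (RP := ⌈(σ + κ) / a β⌉₊ + 1) rfl
  obtain ⟨-, -, hLL₀, hNL₀, -, -⟩ := scales hα hσ hκ h4 hρ' hℓ' hL₀ (RP := ⌈(σ + κ) / a β⌉₊ + 1) rfl
  set N := ⌈σ / a β⌉₊ with hN
  have hθ0 : ∀ x, x ∉ box 4 N → thetaTest 4 v (a β • siteToE x) = 0 := fun x hx =>
    thetaTest_smul_siteToE_eq_zero hα hvσ hx
  have hw0 : ∀ y, y ∉ box 4 N → v (a β • siteToE y) = 0 := fun y hy =>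
    apply_smul_siteToE_eq_zero hα hvσ hy
  -- per-pair torus-to-torus transfer
  have hpair : ∀ x ∈ box 4 N, ∀ y ∈ box 4 N,
      |(torusE G r β L (fun U => dens G r x U * dens G r y U) - torusE G r β L (dens G r x) * torusE G r β L (dens G r y))
        - (torusE G r β (L₀ β) (fun U => dens G r x U * dens G r y U) -
            torusE G r β (L₀ β) (dens G r x) * torusE G r β (L₀ β) (dens G r y))| ≤
      2 * (C₁ * (a β / κ) ^ 4) * (C₁ * (a β / κ) ^ 4) + C₂ * (a β / κ) ^ 4 / (1 + ‖siteToE (y - x)‖) ^ 4 :=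
    fun x hx y hy => pair_transfer_torus G r β hC₁ hC₂ hκ hα hfem hLL hLL₀ hdep (H1 β hβ₁) (H2 β hβ₂) hx hy
  -- the sums restricted to the support box
  have eQ : ∀ M : ℕ, N ≤ M → Q2 G r β M (a β) (thetaTest 4 v) v = ∑ x ∈ box 4 N, ∑ y ∈ box 4 N,
      thetaTest 4 v (a β • siteToE x) * v (a β • siteToE y) *
        (torusE G r β M (fun U => dens G r x U * dens G r y U) -
          torusE G r β M (dens G r x) * torusE G r β M (dens G r y)) := fun M hM => by
    unfold Q2
    exact sum_box₂_eq hM _ (fun x hx y => by rw [hθ0 x hx]; ring) (fun y hy x => by rw [hw0 y hy]; ring)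
  have e1 : ∑ x ∈ box 4 (L₀ β), |thetaTest 4 v (a β • siteToE x)| =
      ∑ x ∈ box 4 N, |thetaTest 4 v (a β • siteToE x)| :=
    sum_box_eq_sum_box hNL₀ _ fun x hx => by rw [hθ0 x hx, abs_zero]
  have e2 : ∑ y ∈ box 4 (L₀ β), |v (a β • siteToE y)| = ∑ y ∈ box 4 N, |v (a β • siteToE y)| :=
    sum_box_eq_sum_box hNL₀ _ fun y hy => by rw [hw0 y hy, abs_zero]
  have e3 : ∑ x ∈ box 4 (L₀ β), ∑ y ∈ box 4 (L₀ β),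
      |thetaTest 4 v (a β • siteToE x)| * |v (a β • siteToE y)| / (1 + ‖siteToE (y - x)‖) ^ 4 =
      ∑ x ∈ box 4 N, ∑ y ∈ box 4 N,
      |thetaTest 4 v (a β • siteToE x)| * |v (a β • siteToE y)| / (1 + ‖siteToE (y - x)‖) ^ 4 :=
    sum_box₂_eq hNL₀ _ (fun x hx y => by rw [hθ0 x hx, abs_zero, zero_mul, zero_div])
      (fun y hy x => by rw [hw0 y hy, abs_zero, mul_zero, zero_div])
  have hsum := sum_sum_sub_le_of_abs_sub_le (box 4 N) (fun x => thetaTest 4 v (a β • siteToE x))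
    (fun y => v (a β • siteToE y))
    (fun x y => torusE G r β L (fun U => dens G r x U * dens G r y U) -
      torusE G r β L (dens G r x) * torusE G r β L (dens G r y))
    (fun x y => torusE G r β (L₀ β) (fun U => dens G r x U * dens G r y U) -
      torusE G r β (L₀ β) (dens G r x) * torusE G r β (L₀ β) (dens G r y))
    (fun x y => C₂ * (a β / κ) ^ 4 / (1 + ‖siteToE (y - x)‖) ^ 4)
    (2 * (C₁ * (a β / κ) ^ 4) * (C₁ * (a β / κ) ^ 4)) hpair
  have e4 : ∑ x ∈ box 4 N, ∑ y ∈ box 4 N, |thetaTest 4 v (a β • siteToE x)| * |v (a β • siteToE y)| *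
      (C₂ * (a β / κ) ^ 4 / (1 + ‖siteToE (y - x)‖) ^ 4) =
      C₂ * (a β / κ) ^ 4 * ∑ x ∈ box 4 N, ∑ y ∈ box 4 N,
        |thetaTest 4 v (a β • siteToE x)| * |v (a β • siteToE y)| / (1 + ‖siteToE (y - x)‖) ^ 4 := by
    rw [Finset.mul_sum]
    refine Finset.sum_congr rfl fun x _ => ?_
    rw [Finset.mul_sum]
    refine Finset.sum_congr rfl fun y _ => ?_
    ring
  rw [eQ (L₀ β) hNL₀, e1, e2, e3] at HRβ
  rw [e4] at hsum
  rw [eQ L hNL]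
  have hprod : 2 * (C₁ * (a β / κ) ^ 4 * ∑ x ∈ box 4 N, |thetaTest 4 v (a β • siteToE x)|) *
      (C₁ * (a β / κ) ^ 4 * ∑ y ∈ box 4 N, |v (a β • siteToE y)|) =
      2 * (C₁ * (a β / κ) ^ 4) * (C₁ * (a β / κ) ^ 4) *
        ((∑ x ∈ box 4 N, |thetaTest 4 v (a β • siteToE x)|) * ∑ y ∈ box 4 N, |v (a β • siteToE y)|) := by ring
  linarith [hsum, HRβ, hprod]

/-- **Three-point floor on every torus, explicit witnesses.**  (E1/E2/E3-osc) and three test functions `f, g, h`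
supported in `closedBall 0 σ` with, for `β ≥ β₅`, ONE torus `2L₀(β)+1` (`a β · L₀(β) ≥ σ + κ + 1`) on which
`|Q3_{β,L₀(β),aβ}(f,g,h)| ≥ ε +` the per-triple transfer margin.  Then THESE `f, g, h` carry `ε ≤ |Q3_{β,L,aβ}(f,g,h)|`
on every torus `2L+1` with `a β · L ≥ σ + κ + 1`, for all large `β` (the landed `lowerBounds_snd_of_torusReference`
with the witnesses kept in the statement). [folklore] -/
theorem floor_snd_of_torusReference (a : ℝ → ℝ) (ha₀ : ∀ β, 0 < a β) (ha : Tendsto a atTop (𝓝 0))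
    {C₁ C₂ C₃ ℓ σ κ : ℝ} (hC₁ : 0 ≤ C₁) (hC₂ : 0 ≤ C₂) (hC₃ : 0 ≤ C₃) (hσ : 0 < σ) (hκ : 0 < κ)
    (hℓ : 2 * (σ + κ) < ℓ)
    (hE1 : ∃ β₁ : ℝ, ∀ β : ℝ, β₁ ≤ β → ∀ (c : Fin 4 → ℤ) (b : ℕ), (b : ℝ) * a β ≤ ℓ →
      ∀ (η η' : LGConfig 4 G) (x : Fin 4 → ℤ), 1 ≤ depth c b x →
        |kerE G r β c b η (dens G r x) - kerE G r β c b η' (dens G r x)| ≤ C₁ / (depth c b x : ℝ) ^ 4)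
    (hE2 : ∃ β₂ : ℝ, ∀ β : ℝ, β₂ ≤ β → ∀ (c : Fin 4 → ℤ) (b : ℕ), (b : ℝ) * a β ≤ ℓ →
      ∀ (η η' : LGConfig 4 G) (x y : Fin 4 → ℤ), 1 ≤ depth c b x → 1 ≤ depth c b y →
        |kerCov G r β c b η (dens G r x) (dens G r y) - kerCov G r β c b η' (dens G r x) (dens G r y)| ≤
          C₂ / ((min (depth c b x) (depth c b y) : ℕ) : ℝ) ^ 4 / (1 + ‖siteToE (y - x)‖) ^ 4)
    (hE3 : ∃ β₃ : ℝ, ∀ β : ℝ, β₃ ≤ β → ∀ (c : Fin 4 → ℤ) (b : ℕ), (b : ℝ) * a β ≤ ℓ →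
      ∀ (η η' : LGConfig 4 G) (x y z : Fin 4 → ℤ), 1 ≤ depth c b x → 1 ≤ depth c b y → 1 ≤ depth c b z →
        |kerK3 G r β c b η x y z - kerK3 G r β c b η' x y z| ≤
          C₃ / ((min (min (depth c b x) (depth c b y)) (depth c b z) : ℕ) : ℝ) ^ 4 /
            (1 + min (min ‖siteToE (y - x)‖ ‖siteToE (z - y)‖) ‖siteToE (z - x)‖) ^ 8)
    {f g h : 𝓢(EuclideanSpace ℝ (Fin 4), ℝ)} {ε β₅ : ℝ} {L₀ : ℝ → ℕ}
    (hfσ : tsupport (f : EuclideanSpace ℝ (Fin 4) → ℝ) ⊆ Metric.closedBall 0 σ)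
    (hgσ : tsupport (g : EuclideanSpace ℝ (Fin 4) → ℝ) ⊆ Metric.closedBall 0 σ)
    (hhσ : tsupport (h : EuclideanSpace ℝ (Fin 4) → ℝ) ⊆ Metric.closedBall 0 σ)
    (HR : ∀ β : ℝ, β₅ ≤ β → σ + κ + 1 ≤ a β * L₀ β ∧
        ε + ∑ x ∈ box 4 (L₀ β), ∑ y ∈ box 4 (L₀ β), ∑ z ∈ box 4 (L₀ β),
            |f (a β • siteToE x)| * |g (a β • siteToE y)| * |h (a β • siteToE z)| *
              (2 * ((C₁ * (a β / κ) ^ 4) * (C₂ * (a β / κ) ^ 4 / (1 + ‖siteToE (z - y)‖) ^ 4) +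
                    (C₁ * (a β / κ) ^ 4) * (C₂ * (a β / κ) ^ 4 / (1 + ‖siteToE (z - x)‖) ^ 4) +
                    (C₁ * (a β / κ) ^ 4) * (C₂ * (a β / κ) ^ 4 / (1 + ‖siteToE (y - x)‖) ^ 4) +
                    (C₁ * (a β / κ) ^ 4) * (C₁ * (a β / κ) ^ 4) * (C₁ * (a β / κ) ^ 4)) +
                C₃ * (a β / κ) ^ 4 / (1 + min (min ‖siteToE (y - x)‖ ‖siteToE (z - y)‖) ‖siteToE (z - x)‖) ^ 8) ≤
          |Q3 G r β (L₀ β) (a β) f g h|) :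
    ∃ β₅' : ℝ, ∀ β : ℝ, β₅' ≤ β → ∀ L : ℕ, σ + κ + 1 ≤ a β * L → ε ≤ |Q3 G r β L (a β) f g h| := by
  -- adapted from the landed `Reference.lowerBounds_snd_of_torusReference` (same proof, witnesses explicit)
  obtain ⟨β₁, H1⟩ := hE1
  obtain ⟨β₂, H2⟩ := hE2
  obtain ⟨β₃, H3⟩ := hE3
  have hδ : 0 < min (1 / 4 : ℝ) ((ℓ - 2 * (σ + κ)) / 5) := lt_min (by norm_num) (by linarith)
  obtain ⟨βa, Ha⟩ := eventually_le_of_tendsto ha hδ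
  refine ⟨max (max β₅ βa) (max (max β₁ β₂) β₃), fun β hβ L hL => ?_⟩
  have hβ₅ : β₅ ≤ β := le_trans (le_max_left _ _) (le_trans (le_max_left _ _) hβ)
  have hβa : βa ≤ β := le_trans (le_max_right _ _) (le_trans (le_max_left _ _) hβ)
  have hβ₁ : β₁ ≤ β := le_trans (le_max_left _ _) (le_trans (le_max_left _ _) (le_trans (le_max_right _ _) hβ))
  have hβ₂ : β₂ ≤ β := le_trans (le_max_right _ _) (le_trans (le_max_left _ _) (le_trans (le_max_right _ _) hβ))
  have hβ₃ : β₃ ≤ β := le_trans (le_max_right _ _) (le_trans (le_max_right _ _) hβ)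
  have hα : 0 < a β := ha₀ β
  have hsmall := Ha β hβa
  have h4 : a β ≤ 1 / 4 := hsmall.trans (min_le_left _ _)
  have hℓ' : a β ≤ (ℓ - 2 * (σ + κ)) / 5 := hsmall.trans (min_le_right _ _)
  have hρ' : a β ≤ ((σ + κ + 2 * a β) - σ - κ) / 2 := by linarith
  obtain ⟨hL₀, HRβ⟩ := HR β hβ₅
  obtain ⟨-, hfem, hLL, hNL, -, hdep⟩ := scales hα hσ hκ h4 hρ' hℓ' hL (RP := ⌈(σ + κ) / a β⌉₊ + 1) rfl
  obtain ⟨-, -, hLL₀, hNL₀, -, -⟩ := scales hα hσ hκ h4 hρ' hℓ' hL₀ (RP := ⌈(σ + κ) / a β⌉₊ + 1) rfl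
  set N := ⌈σ / a β⌉₊ with hN
  have hf0 : ∀ x, x ∉ box 4 N → f (a β • siteToE x) = 0 := fun x hx => apply_smul_siteToE_eq_zero hα hfσ hx
  have hg0 : ∀ y, y ∉ box 4 N → g (a β • siteToE y) = 0 := fun y hy => apply_smul_siteToE_eq_zero hα hgσ hy
  have hh0 : ∀ z, z ∉ box 4 N → h (a β • siteToE z) = 0 := fun z hz => apply_smul_siteToE_eq_zero hα hhσ hz
  have htriple : ∀ x ∈ box 4 N, ∀ y ∈ box 4 N, ∀ z ∈ box 4 N,
      |torusK3 G r β L x y z - torusK3 G r β (L₀ β) x y z| ≤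
      2 * ((C₁ * (a β / κ) ^ 4) * (C₂ * (a β / κ) ^ 4 / (1 + ‖siteToE (z - y)‖) ^ 4) +
            (C₁ * (a β / κ) ^ 4) * (C₂ * (a β / κ) ^ 4 / (1 + ‖siteToE (z - x)‖) ^ 4) +
            (C₁ * (a β / κ) ^ 4) * (C₂ * (a β / κ) ^ 4 / (1 + ‖siteToE (y - x)‖) ^ 4) +
            (C₁ * (a β / κ) ^ 4) * (C₁ * (a β / κ) ^ 4) * (C₁ * (a β / κ) ^ 4)) +
        C₃ * (a β / κ) ^ 4 / (1 + min (min ‖siteToE (y - x)‖ ‖siteToE (z - y)‖) ‖siteToE (z - x)‖) ^ 8 :=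
    fun x hx y hy z hz => triple_transfer_torus G r β hC₁ hC₂ hC₃ hκ hα hfem hLL hLL₀ hdep (H1 β hβ₁) (H2 β hβ₂)
      (H3 β hβ₃) hx hy hz
  have eQ : ∀ M : ℕ, N ≤ M → Q3 G r β M (a β) f g h = ∑ x ∈ box 4 N, ∑ y ∈ box 4 N, ∑ z ∈ box 4 N,
      f (a β • siteToE x) * g (a β • siteToE y) * h (a β • siteToE z) * torusK3 G r β M x y z := fun M hM => by
    unfold Q3
    exact sum_box₃_eq hM _ (fun x hx y z => by rw [hf0 x hx]; ring) (fun y hy x z => by rw [hg0 y hy]; ring)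
      (fun z hz x y => by rw [hh0 z hz]; ring)
  have eM : ∑ x ∈ box 4 (L₀ β), ∑ y ∈ box 4 (L₀ β), ∑ z ∈ box 4 (L₀ β),
      |f (a β • siteToE x)| * |g (a β • siteToE y)| * |h (a β • siteToE z)| *
        (2 * ((C₁ * (a β / κ) ^ 4) * (C₂ * (a β / κ) ^ 4 / (1 + ‖siteToE (z - y)‖) ^ 4) +
              (C₁ * (a β / κ) ^ 4) * (C₂ * (a β / κ) ^ 4 / (1 + ‖siteToE (z - x)‖) ^ 4) +
              (C₁ * (a β / κ) ^ 4) * (C₂ * (a β / κ) ^ 4 / (1 + ‖siteToE (y - x)‖) ^ 4) +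
              (C₁ * (a β / κ) ^ 4) * (C₁ * (a β / κ) ^ 4) * (C₁ * (a β / κ) ^ 4)) +
          C₃ * (a β / κ) ^ 4 / (1 + min (min ‖siteToE (y - x)‖ ‖siteToE (z - y)‖) ‖siteToE (z - x)‖) ^ 8) =
      ∑ x ∈ box 4 N, ∑ y ∈ box 4 N, ∑ z ∈ box 4 N,
      |f (a β • siteToE x)| * |g (a β • siteToE y)| * |h (a β • siteToE z)| *
        (2 * ((C₁ * (a β / κ) ^ 4) * (C₂ * (a β / κ) ^ 4 / (1 + ‖siteToE (z - y)‖) ^ 4) +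
              (C₁ * (a β / κ) ^ 4) * (C₂ * (a β / κ) ^ 4 / (1 + ‖siteToE (z - x)‖) ^ 4) +
              (C₁ * (a β / κ) ^ 4) * (C₂ * (a β / κ) ^ 4 / (1 + ‖siteToE (y - x)‖) ^ 4) +
              (C₁ * (a β / κ) ^ 4) * (C₁ * (a β / κ) ^ 4) * (C₁ * (a β / κ) ^ 4)) +
          C₃ * (a β / κ) ^ 4 / (1 + min (min ‖siteToE (y - x)‖ ‖siteToE (z - y)‖) ‖siteToE (z - x)‖) ^ 8) :=
    sum_box₃_eq hNL₀ _ (fun x hx y z => by rw [hf0 x hx, abs_zero]; ring)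
      (fun y hy x z => by rw [hg0 y hy, abs_zero]; ring) (fun z hz x y => by rw [hh0 z hz, abs_zero]; ring)
  have hsum := abs_sum₃_sub_sum₃_le (box 4 N) (fun x => f (a β • siteToE x)) (fun y => g (a β • siteToE y))
    (fun z => h (a β • siteToE z)) (fun x y z => torusK3 G r β L x y z)
    (fun x y z => torusK3 G r β (L₀ β) x y z) _ htriple
  rw [eQ (L₀ β) hNL₀, eM] at HRβ
  rw [eQ L hNL]
  have tri := abs_sub_abs_le_abs_sub
    (∑ x ∈ box 4 N, ∑ y ∈ box 4 N, ∑ z ∈ box 4 N,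
      f (a β • siteToE x) * g (a β • siteToE y) * h (a β • siteToE z) * torusK3 G r β (L₀ β) x y z)
    (∑ x ∈ box 4 N, ∑ y ∈ box 4 N, ∑ z ∈ box 4 N,
      f (a β • siteToE x) * g (a β • siteToE y) * h (a β • siteToE z) * torusK3 G r β L x y z)
  rw [abs_sub_comm] at hsum
  linarith [hsum, HRβ, tri]

end Torus

end Summit.QuantumFields.YangMills.Cruxes.HypercubicOSDataFromInfiniteVolume.OnsetFloorsN

end
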